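import Mathlib
import HarnessLib
import Summits.QuantumAdvantage.QuantumAdvantage.Theses.CubicForrelation
import Literature.Computability.QuantumComplexity.Forrelation
import Literature.Computability.QuantumComplexity.CubicForrelation
import Literature.Computability.QuantumComplexity.ForrelationDerivativeTables
import Literature.Computability.QuantumComplexity.ForrelationDirectSum

/-!
# Sketch — crux-ideate stmt-QuantumAdvantage-14043 (NearExactIsExact), ideator 1 (k = 1), round 1

First lemmas of the idea cards `slab-decoupling-local-isolation` (§1) and `two-sided-almost-bentness` (§2),
plus the degree-4 capture identity both cards lean on (§3, known on this crux: refuter ATTACK.md (A)).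
Statements only (`sorry` bodies) except the glue `crux_of_stability_and_local`, which is proved.
-/

noncomputable section

namespace Summit.QuantumAdvantage.QuantumAdvantage.Cruxes.NearExactIsExact.Ideator1

open Finset
open Literature.Computability.QuantumComplexity
open Literature.Computability.QuantumComplexity.DerivativeWalsh
open Literature.Computability.QuantumComplexity.BuzetChailloux (bxor zeroVec)
open Summit.QuantumAdvantage.QuantumAdvantage.Theses.CubicForrelation (NearExactIsExact)

variable {n : ℕ}

/-- Hamming distance of two Boolean functions. -/
def hdist (f g : (Fin n → Bool) → Bool) : ℕ := (univ.filter fun x => f x ≠ g x).card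

/-! ## §1  Card `slab-decoupling-local-isolation` -/

/-- LOCAL ISOLATION at radius 1/4 (the Kasami–Tokura–Azumi regime): a cubic pair within Hamming radius
`2ⁿ/4` (both sides) of an EXACT cubic pair is itself exact or has `Φ ≤ θ`.  A literal sub-case of the crux. -/
def LocalIsolation : Prop :=
  ∃ θ : ℝ, θ < 1 ∧ ∀ n : ℕ, Even n → ∀ f₀ g₀ f g : (Fin n → Bool) → Bool,
    IsDegLeFun 3 f₀ → IsDegLeFun 3 g₀ → IsDegLeFun 3 f → IsDegLeFun 3 g →
    forrelation f₀ g₀ = 1 → 4 * hdist f f₀ ≤ 2 ^ n → 4 * hdist g g₀ ≤ 2 ^ n →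
    θ < forrelation f g → forrelation f g = 1

/-- HIGH-THRESHOLD STABILITY = REPAIR-MEMO option (R1) with the threshold existential (the refuted
`CubicStability` had `θ = 3/5`; P₄, P₂⊗T, T^{⊗3} all sit below 0.8). NOT this card's job — the other half. -/
def HighThresholdStability : Prop :=
  ∃ θ : ℝ, θ < 1 ∧ ∀ n : ℕ, Even n → ∀ f g : (Fin n → Bool) → Bool,
    IsDegLeFun 3 f → IsDegLeFun 3 g → θ < forrelation f g →
    ∃ f₀ g₀ : (Fin n → Bool) → Bool, IsDegLeFun 3 f₀ ∧ IsDegLeFun 3 g₀ ∧ forrelation f₀ g₀ = 1 ∧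
      4 * hdist f f₀ ≤ 2 ^ n ∧ 4 * hdist g g₀ ≤ 2 ^ n

/-- GLUE (proved): the crux is exactly stability-at-some-threshold PLUS local isolation. -/
theorem crux_of_stability_and_local (hS : HighThresholdStability) (hL : LocalIsolation) :
    NearExactIsExact := by
  obtain ⟨θ₁, hθ₁, h₁⟩ := hS
  obtain ⟨θ₂, hθ₂, h₂⟩ := hL
  refine ⟨max θ₁ θ₂, max_lt hθ₁ hθ₂, ?_⟩
  intro n hn f g hf hg hΦ
  have hΦ₁ : θ₁ < forrelation f g := lt_of_le_of_lt (le_max_left _ _) hΦ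
  have hΦ₂ : θ₂ < forrelation f g := lt_of_le_of_lt (le_max_right _ _) hΦ
  obtain ⟨f₀, g₀, hf₀, hg₀, hex, hdf, hdg⟩ := h₁ n hn f g hf hg hΦ₁
  exact h₂ n hn f₀ g₀ f g hf₀ hg₀ hf hg hex hdf hdg hΦ₂

/-- FIRST LEMMA (flat × flat isolation, paper-proved in the card, θ = 127/128).  `(f₀,g₀)` an exact cubic
pair, `T, S` codim-3 flats (cut out by three characters `(-1)^{v_i·x} = (-1)^{a_i}`, cardinality `2ⁿ/8`);
then the two-sided Kasami–Tokura perturbation `(f₀ ⊕ 1_T, g₀ ⊕ 1_S)` has `Φ = 1` or `Φ ≤ 127/128`.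
Proof route: four-term identity `Φ = 1/2 + 4D`; if the flats are not in degenerate position
(`dir T ⊉ (dir S)^⊥`) the operator norm of the quotient Hadamard kernel gives `Φ ≤ 1/2 + 2^{-3/2}`;
in degenerate position `1 - Φ = (1/128) Σ_{64 cells} (1 - ε_i Φ_i)` over the `(n-6)`-variable slab
restrictions; cells in one row differ by QUADRATIC twists of `g₀`'s slices, so two near-exact cells in
different classes are impossible (`d_min RM(2) = 1/4` vs `‖χ-χ'‖² ≤ 8δ'`), giving `1 - Φ ≥ 1/128` unless
both slabs DECOUPLE, and then the Walsh identity `Λ·W_γ = 2^{n/2-3} K (-1)^φ` forces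
`Φ ∈ {1/2, 17/32, 5/8, 25/32, 1}`. -/
theorem flat_flat_isolation (f₀ g₀ : (Fin n → Bool) → Bool)
    (hf : IsDegLeFun 3 f₀) (hg : IsDegLeFun 3 g₀) (hex : forrelation f₀ g₀ = 1)
    (T S : Finset (Fin n → Bool))
    (hT : ∃ (v : Fin 3 → (Fin n → Bool)) (a : Fin 3 → Bool), ∀ x, x ∈ T ↔ ∀ i, twist (v i) x = signOf (a i))
    (hS : ∃ (w : Fin 3 → (Fin n → Bool)) (b : Fin 3 → Bool), ∀ y, y ∈ S ↔ ∀ i, twist (w i) y = signOf (b i))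
    (hTc : 8 * T.card = 2 ^ n) (hSc : 8 * S.card = 2 ^ n) :
    forrelation (fun x => xor (f₀ x) (decide (x ∈ T))) (fun y => xor (g₀ y) (decide (y ∈ S))) = 1 ∨
      forrelation (fun x => xor (f₀ x) (decide (x ∈ T))) (fun y => xor (g₀ y) (decide (y ∈ S))) ≤ 127 / 128 := by
  sorry

/-- BLOCK IDENTITY the degenerate case rests on (iterate of `forrelation_snoc` / `twist_append`):
`Φ(f,g) = 2^{-9} Σ_{X,Y ∈ 𝔽₂⁶} (-1)^{X·Y} Φ(f(X,·), g(Y,·))`. -/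
theorem forrelation_block6 (n' : ℕ) (f g : (Fin (6 + n') → Bool) → Bool) :
    forrelation f g = ((2 : ℝ) ^ 9)⁻¹ * ∑ X : Fin 6 → Bool, ∑ Y : Fin 6 → Bool,
      twist X Y * forrelation (fun x => f (Fin.append X x)) (fun y => g (Fin.append Y y)) := by
  sorry

/-! ## §2  Card `two-sided-almost-bentness` -/

/-- CAPACITY FORM ⇒ crux (unique decoding in RM(3,n)): the crux is a statement about the cubic CAPTURE
`C₃(g) = max_{f cubic} Φ(f,g)` of ONE cubic function. -/
theorem crux_of_capacity_form
    (h : ∃ θ : ℝ, θ < 1 ∧ ∀ n : ℕ, Even n → ∀ g : (Fin n → Bool) → Bool, IsDegLeFun 3 g →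
      (∃ f : (Fin n → Bool) → Bool, IsDegLeFun 3 f ∧ θ < forrelation f g) →
      ∃ d : (Fin n → Bool) → Bool, IsDegLeFun 3 d ∧ forrelation d g = 1) :
    NearExactIsExact := by
  sorry

/-- TWO-SIDED L¹-ALMOST-BENTNESS (no degree hypothesis): with `G = 2^{-n/2} W_g`, `F = (-1)^f`,
`‖G - F‖₂² = 2(1-Φ)` and `G² - 1 = (G-F)(G+F)` give `E|G² - 1| ≤ 2√(2(1-Φ))`; unnormalised: -/
theorem almost_bent_of_near_exact (f g : (Fin n → Bool) → Bool) :
    ∑ x, |W (fun y => signOf (g y)) x ^ 2 - (2 : ℝ) ^ n| ≤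
      2 * Real.sqrt (2 * (1 - forrelation f g)) * (2 : ℝ) ^ (2 * n) := by
  sorry

/-- HIGH RANK OF UNBALANCED DERIVATIVES: for `w ≠ 0`, `Σ_x W_g(x)² (-1)^{w·x} = 2ⁿ A_g(w)` with
`A_g(w) = Σ_y (-1)^{g(y)+g(y⊕w)}`, so `|A_g(w)| ≤ 2√(2(1-Φ))·2ⁿ`; for CUBIC `g` (n even) `A_g(w)` is `0` or
`± 2^{(n+k_w)/2}` with `k_w = dim rad(D_w g)`, hence every UNBALANCED derivative has rank
`n - k_w ≥ log₂(1/(1-Φ)) - 3`: near-exact pairs have no low-rank unbalanced derivative on either side. -/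
theorem autocorr_le_of_near_exact (f g : (Fin n → Bool) → Bool) (w : Fin n → Bool) (hw : w ≠ zeroVec) :
    |∑ y, signOf (g y) * signOf (g (bxor y w))| ≤ 2 * Real.sqrt (2 * (1 - forrelation f g)) * (2 : ℝ) ^ n := by
  sorry

/-! ## §3  Known on this crux (refuter ATTACK.md (A)); both cards lean on it -/

/-- DEGREE-4 CAPTURE IDENTITY. `π` a quadratic permutation of `𝔽₂^m` with inverse `ψ`, `S` any quadratic
map: the coordinates of `π ∘ S + id` lie in `RM(4,m)` and vanish on `{ψ = S}`, so
`16·#{ψ ≠ S} < 2^m ⇒ ψ = S`. -/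
theorem quadPerm_inverse_gap (m : ℕ) (π ψ S : (Fin m → Bool) → (Fin m → Bool))
    (hπ : ∀ i, IsDegLeFun 2 (fun y => π y i)) (hS : ∀ i, IsDegLeFun 2 (fun y => S y i))
    (hψπ : Function.LeftInverse ψ π) (hπψ : Function.RightInverse ψ π)
    (hclose : 16 * (univ.filter fun x => ψ x ≠ S x).card < 2 ^ m) :
    ψ = S := by
  sorry

end Summit.QuantumAdvantage.QuantumAdvantage.Cruxes.NearExactIsExact.Ideator1
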